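import Summits.AtomisticToContinuum.HydrodynamicLimit.Theorems.JParityClosureLocalSecondLawRegularRangeTools
import Summits.AtomisticToContinuum.HydrodynamicLimit.Theorems.JParityClosureDensityCapMeanDisplacement

/-!
# Off the grid events a good configuration is regular (stub F = `stub_regularRange` of the entropy-ledger
# line, crux `JParityClosure.LocalSecondLaw`, stmt-AtomisticToContinuum-13081)

The deterministic `ε/5`-bookkeeping of the reduction `regularRange_of_fieldLLN`
(`Theorems/JParityClosureLocalSecondLawRegularRangeReduction.lean`): at fixed particle number, for ONE
hard-sphere flow `Ψ` on `𝕋³` and ONE good configuration `z` of kinetic energy per particle `≤ K`, if at the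
points of a finite space–time net the coarse fields `(ρ_r, m_r, e_r)(Ψ_k z)(x_l)` are within `ε/5` of the
cone averages of continuous limit fields `(ρ, ρu, E)(k)` and the coarse momentum / kinetic energy oscillate
by at most `ε/5` on the time window of each net time, then the orbit of `z` is in the regular range
`c ≤ ρ_r`, `ρ_rσ³ ≤ η₁`, `c ≤ θ_r` on ALL of `[0, τ] × 𝕋³` (`regular_of_gridEvents`, registered sub-goal;
the three-field, two-sided analogue of `stub_capEventSubset` of the sibling crux `DensityCap`). The density
is moved in time by the Lipschitz clock (`gridUp_clock`, `stub_meanDisplacement`) and all three fields in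
the centre by the kernel bound; the velocity-weighted fields have no clock, whence the window hypothesis.

References: elementary bookkeeping over the tools of
`Theorems/JParityClosureLocalSecondLawRegularRangeTools.lean` and the grid-upgrade files of `DensityCap`.
-/

noncomputable section

namespace Summit.AtomisticToContinuum.HydrodynamicLimit.Theorems.LocalSecondLawLedger

open scoped BigOperators Topology Classical MeasureTheory ENNReal InnerProductSpace
open Filter Set MeasureTheory
open Literature.MathematicalPhysics.KineticTheory
open Literature.Analysis.FluidPDE
open Literature.Analysis.FunctionSpaces (Torus.stLift Torus.stLift_apply Torus.proj Torus.proj_add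
  Torus.continuous_slice_of_continuousOn_stLift Torus.continuousOn_stLift_comp₂)
open Summit.AtomisticToContinuum.HydrodynamicLimit.Theorems.LocalSecondLawNegative

/-! ## Off the grid events a good configuration is regular (deterministic bookkeeping) -/

/-- **Regular off the grid events** (registered sub-goal `regular_of_gridEvents`; the deterministic `ε/5`-bookkeeping of the reduction, at fixed `N`,
for ONE flow `Ψ` and ONE good configuration `z` of energy `≤ K`; the three-field, two-sided analogue of
`stub_capEventSubset`). Data: floors `2c`, velocity bound `B`, cap margin and a joint modulus (scale `ϖ`,
tolerance `ε/5`) of the limit fields on `[0, τ] × 𝕋³`; a radius `0 < r ≤ 1/2`, `r < ϖ`; meshes `δx, δt < ϖ`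
with `3/(πr⁴)(|K| + 1)δx ≤ ε/5`, `3/(πr⁴)√(2K)δt ≤ ε/5`; an `x`-net `Sx` of mesh `δx`; a time net
`St ⊆ [0, τ]` such that every `s ∈ [0, τ]` is within `δt` and within the windows `wf l k` (`l ∈ Sx`) of
some `k ∈ St`. IF at every net point `(k, l)` the coarse fields of `Ψ_k z` are within `ε/5` of the cone
averages of `(ρ, ρu, E)(k)` and the oscillation of `(m_r, e_r)(Ψ_· z)(l)` on the window of `k` is `≤ ε/5`,
THEN `z` is regular: chaining centre-Lipschitz bounds (`gridUp_abs_mollDensity_sub_le_centre`,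
`rr_norm_momC_sub_le_centre`, `rr_abs_kinC_sub_le_centre`, energy conservation `ke_flow_eq`), the density
clock (`gridUp_clock` with `stub_meanDisplacement`) resp. the window hypothesis, the net hypothesis, the
cone-average error (`rr_abs_integral_cone_mul_sub_le`, `rr_norm_integral_cone_smul_sub_le`) and the modulus
gives `ε`-closeness at every `(s, x)`, and `regularAt_of_fieldsClose` the regular inequalities. -/
theorem regular_of_gridEvents :
  ∀ (σ η₁ τ c ε B K r δx δt ϖ : ℝ) (ρ θ : ℝ → T3 → ℝ) (u : ℝ → T3 → V3),
    0 < r → r ≤ 1 / 2 → r < ϖ → 0 < c → 0 < ε → 0 ≤ B → ε * (B ^ 2 + 2 * B + 3 * c + 2) ≤ c ^ 2 →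
    (∀ s ∈ Set.Icc 0 τ, ∀ x, 2 * c ≤ ρ s x) → (∀ s ∈ Set.Icc 0 τ, ∀ x, 2 * c ≤ θ s x) →
    (∀ s ∈ Set.Icc 0 τ, ∀ x, ‖u s x‖ ≤ B) → (∀ s ∈ Set.Icc 0 τ, ∀ x, ρ s x * σ ^ 3 + ε * |σ ^ 3| ≤ η₁) →
    (∀ s ∈ Set.Icc 0 τ, Continuous (ρ s)) → (∀ s ∈ Set.Icc 0 τ, Continuous fun y => ρ s y • u s y) →
    (∀ s ∈ Set.Icc 0 τ, Continuous fun y => totalEnergyDensity (ρ s y) (u s y) (θ s y)) →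
    (∀ s ∈ Set.Icc 0 τ, ∀ s' ∈ Set.Icc 0 τ, |s - s'| < ϖ → ∀ x x' : T3, Torus.euclidDist x x' < ϖ →
      |ρ s x - ρ s' x'| ≤ ε / 5) →
    (∀ s ∈ Set.Icc 0 τ, ∀ s' ∈ Set.Icc 0 τ, |s - s'| < ϖ → ∀ x x' : T3, Torus.euclidDist x x' < ϖ →
      ‖ρ s x • u s x - ρ s' x' • u s' x'‖ ≤ ε / 5) →
    (∀ s ∈ Set.Icc 0 τ, ∀ s' ∈ Set.Icc 0 τ, |s - s'| < ϖ → ∀ x x' : T3, Torus.euclidDist x x' < ϖ →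
      |totalEnergyDensity (ρ s x) (u s x) (θ s x) - totalEnergyDensity (ρ s' x') (u s' x') (θ s' x')| ≤ ε / 5) →
    δx < ϖ → δt < ϖ → 3 / (Real.pi * r ^ 4) * (|K| + 1) * δx ≤ ε / 5 →
    3 / (Real.pi * r ^ 4) * Real.sqrt (2 * K) * δt ≤ ε / 5 →
    ∀ (Sx : Finset T3), (∀ x : T3, ∃ l ∈ Sx, Torus.euclidDist x l ≤ δx) →
    ∀ (St : Finset ℝ), (∀ k ∈ St, k ∈ Set.Icc 0 τ) → ∀ (wf : T3 → ℝ → ℝ),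
    (∀ s ∈ Set.Icc 0 τ, ∃ k ∈ St, |s - k| ≤ δt ∧ ∀ l ∈ Sx, |s - k| ≤ wf l k) →
    ∀ (N : ℕ) (Ψ : Flow σ N) (z : Phase N), z ∈ Ψ.good → ((N + 1 : ℕ) : ℝ)⁻¹ * configEnergy z ≤ K →
    (∀ k ∈ St, ∀ l ∈ Sx,
      |rhoC r (Ψ.flow k z) l - ∫ y, cone r y l * ρ k y| ≤ ε / 5 ∧
      ‖momC r (Ψ.flow k z) l - ∫ y, (cone r y l * ρ k y) • u k y‖ ≤ ε / 5 ∧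
      |kinC r (Ψ.flow k z) l - ∫ y, cone r y l * totalEnergyDensity (ρ k y) (u k y) (θ k y)| ≤ ε / 5 ∧
      ∀ s' ∈ Set.Icc 0 τ, |s' - k| ≤ wf l k →
        ‖momC r (Ψ.flow s' z) l - momC r (Ψ.flow k z) l‖ +
          |kinC r (Ψ.flow s' z) l - kinC r (Ψ.flow k z) l| ≤ ε / 5) →
    Regular σ r τ c η₁ Ψ z := by
  intro σ η₁ τ c ε B K r δx δt ϖ ρ θ u hr hr2 hrϖ hc hε hB0 hεD hcρ hcθ hBle hcap hρk hmk hEk hmod₁ hmod₂ hmod₃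
    hδxϖ hδtϖ hδx₂ hδt₂ Sx hSx St hSt wf hnet N Ψ z hg hKz hA
  refine ⟨hg, fun s hs x => ?_⟩
  obtain ⟨k, hk, hsk_δt, hsk_wf⟩ := hnet s hs
  have hkI : k ∈ Icc 0 τ := hSt k hk
  obtain ⟨l, hl, hxl⟩ := hSx x
  obtain ⟨h3ρ, h3m, h3e, hzo⟩ := hA k hk l hl
  set ε₅ : ℝ := ε / 5 with hε₅def
  set L : ℝ := 3 / (Real.pi * r ^ 4) with hLdef
  have hL : 0 < L := by positivity
  set Ka : ℝ := |K| + 1 with hKadef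
  set w : Phase N := Ψ.flow s z with hw
  set wk : Phase N := Ψ.flow k z with hwk
  have hsk_ϖ : |s - k| < ϖ := lt_of_le_of_lt hsk_δt hδtϖ
  have hxl_ϖ : Torus.euclidDist x l < ϖ := lt_of_le_of_lt hxl hδxϖ
  have hd0 : 0 ≤ Torus.euclidDist x l := by rw [Torus.euclidDist_eq]; positivity
  have hLδx : 0 ≤ L * δx := mul_nonneg hL.le (hd0.trans hxl)
  -- the energy along the orbit
  have hkew : ke w = ((N + 1 : ℕ) : ℝ)⁻¹ * configEnergy z := by
    rw [hw, ke_flow_eq Ψ hg s, rr_ke_eq]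
  have hkeK : ke w ≤ K := hkew ▸ hKz
  have hke0 : 0 ≤ ke w := ke_nonneg w
  have h2o : ‖momC r w l - momC r wk l‖ + |kinC r w l - kinC r wk l| ≤ ε₅ := hzo s hs (hsk_wf l hl)
  -- link 1: from the centre `x` to the net centre `l` at time `s`
  have hLδ : L * Torus.euclidDist x l ≤ L * δx := mul_le_mul_of_nonneg_left hxl hL.le
  have hLδK : L * δx * Ka ≤ ε₅ := by
    calc L * δx * Ka = L * Ka * δx := by ring
      _ ≤ ε₅ := hδx₂
  have h1ρ : |rhoC r w x - rhoC r w l| ≤ ε₅ := by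
    have h : |rhoC r w x - rhoC r w l| ≤ L * Torus.euclidDist x l :=
      gridUp_abs_mollDensity_sub_le_centre hr w x l
    have h' : L * δx * 1 ≤ L * δx * Ka :=
      mul_le_mul_of_nonneg_left (by linarith [abs_nonneg K]) hLδx
    linarith
  have h1m : ‖momC r w x - momC r w l‖ ≤ ε₅ := by
    have h : ‖momC r w x - momC r w l‖ ≤ L * Torus.euclidDist x l * (1 / 2 + ke w) :=
      rr_norm_momC_sub_le_centre hr w x l
    have h' : L * Torus.euclidDist x l * (1 / 2 + ke w) ≤ L * δx * Ka :=
      mul_le_mul hLδ (by linarith [le_abs_self K]) (by linarith) hLδx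
    linarith
  have h1e : |kinC r w x - kinC r w l| ≤ ε₅ := by
    have h : |kinC r w x - kinC r w l| ≤ L * Torus.euclidDist x l * ke w :=
      rr_abs_kinC_sub_le_centre hr w x l
    have h' : L * Torus.euclidDist x l * ke w ≤ L * δx * Ka :=
      mul_le_mul hLδ (by linarith [le_abs_self K]) hke0 hLδx
    linarith
  -- link 2: from time `s` to the net time `k` at the net centre `l`
  have h2ρ : |rhoC r w l - rhoC r wk l| ≤ ε₅ := by
    have hclock : |rhoC r w l - rhoC r wk l| ≤
        L * Real.sqrt (2 * (((N + 1 : ℕ) : ℝ)⁻¹ * configEnergy z)) * |s - k| :=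
      gridUp_clock hr Ψ (stub_meanDisplacement Ψ hg) k s l
    exact hclock.trans ((capSub_clock_mono hL.le hKz hsk_δt).trans hδt₂)
  have h2m : ‖momC r w l - momC r wk l‖ ≤ ε₅ :=
    le_trans (le_add_of_nonneg_right (abs_nonneg _)) h2o
  have h2e : |kinC r w l - kinC r wk l| ≤ ε₅ :=
    le_trans (le_add_of_nonneg_left (norm_nonneg _)) h2o
  -- link 4: the two-sided cone-average error at the net point `(k, l)`
  have hkk₀ : |k - k| < ϖ := by
    rw [sub_self, abs_zero]
    exact hr.trans hrϖ
  have h4ρ : |(∫ y, cone r y l * ρ k y) - ρ k l| ≤ ε₅ :=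
    rr_abs_integral_cone_mul_sub_le hr hr2 (hρk k hkI) l fun y hy =>
      hmod₁ k hkI k hkI hkk₀ y l (hy.trans hrϖ)
  have h4m : ‖(∫ y, (cone r y l * ρ k y) • u k y) - ρ k l • u k l‖ ≤ ε₅ := by
    have h := rr_norm_integral_cone_smul_sub_le hr hr2 (hmk k hkI) l fun y hy =>
      hmod₂ k hkI k hkI hkk₀ y l (hy.trans hrϖ)
    have heq : (∫ y, (cone r y l * ρ k y) • u k y) = ∫ y, cone r y l • (ρ k y • u k y) :=
      integral_congr_ae (ae_of_all _ fun y => (smul_smul (cone r y l) (ρ k y) (u k y)).symm)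
    rw [heq]
    exact h
  have h4e : |(∫ y, cone r y l * totalEnergyDensity (ρ k y) (u k y) (θ k y)) -
      totalEnergyDensity (ρ k l) (u k l) (θ k l)| ≤ ε₅ :=
    rr_abs_integral_cone_mul_sub_le hr hr2 (hEk k hkI) l fun y hy =>
      hmod₃ k hkI k hkI hkk₀ y l (hy.trans hrϖ)
  -- link 5: the joint modulus from the net point `(k, l)` to `(s, x)`
  have hks : |k - s| < ϖ := by rw [abs_sub_comm]; exact hsk_ϖ
  have hlx : Torus.euclidDist l x < ϖ := by rw [Torus.euclidDist_comm]; exact hxl_ϖ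
  have h5ρ : |ρ k l - ρ s x| ≤ ε₅ := hmod₁ k hkI s hs hks l x hlx
  have h5m : ‖ρ k l • u k l - ρ s x • u s x‖ ≤ ε₅ := hmod₂ k hkI s hs hks l x hlx
  have h5e : |totalEnergyDensity (ρ k l) (u k l) (θ k l) -
      totalEnergyDensity (ρ s x) (u s x) (θ s x)| ≤ ε₅ := hmod₃ k hkI s hs hks l x hlx
  -- chaining
  have hε5 : ε₅ + ε₅ + ε₅ + ε₅ + ε₅ = ε := by rw [hε₅def]; ring
  have hρclose : |rhoC r w x - ρ s x| ≤ ε := by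
    have t1 := abs_sub_le (rhoC r w x) (rhoC r w l) (ρ s x)
    have t2 := abs_sub_le (rhoC r w l) (rhoC r wk l) (ρ s x)
    have t3 := abs_sub_le (rhoC r wk l) (∫ y, cone r y l * ρ k y) (ρ s x)
    have t4 := abs_sub_le (∫ y, cone r y l * ρ k y) (ρ k l) (ρ s x)
    linarith
  have hmclose : ‖momC r w x - ρ s x • u s x‖ ≤ ε := by
    have t1 := norm_sub_le_norm_sub_add_norm_sub (momC r w x) (momC r w l) (ρ s x • u s x)
    have t2 := norm_sub_le_norm_sub_add_norm_sub (momC r w l) (momC r wk l) (ρ s x • u s x)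
    have t3 := norm_sub_le_norm_sub_add_norm_sub (momC r wk l) (∫ y, (cone r y l * ρ k y) • u k y)
      (ρ s x • u s x)
    have t4 := norm_sub_le_norm_sub_add_norm_sub (∫ y, (cone r y l * ρ k y) • u k y) (ρ k l • u k l)
      (ρ s x • u s x)
    linarith
  have heclose : |kinC r w x - totalEnergyDensity (ρ s x) (u s x) (θ s x)| ≤ ε := by
    have t1 := abs_sub_le (kinC r w x) (kinC r w l) (totalEnergyDensity (ρ s x) (u s x) (θ s x))
    have t2 := abs_sub_le (kinC r w l) (kinC r wk l) (totalEnergyDensity (ρ s x) (u s x) (θ s x))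
    have t3 := abs_sub_le (kinC r wk l) (∫ y, cone r y l * totalEnergyDensity (ρ k y) (u k y) (θ k y))
      (totalEnergyDensity (ρ s x) (u s x) (θ s x))
    have t4 := abs_sub_le (∫ y, cone r y l * totalEnergyDensity (ρ k y) (u k y) (θ k y))
      (totalEnergyDensity (ρ k l) (u k l) (θ k l)) (totalEnergyDensity (ρ s x) (u s x) (θ s x))
    linarith
  -- the point estimate
  obtain ⟨q1, q2, q3⟩ := regularAt_of_fieldsClose σ η₁ c B ε _ _ _ _ _ _ hc (hcρ s hs x) (hcθ s hs x) hB0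
    (hBle s hs x) (hcap s hs x) hε.le hεD hρclose hmclose heclose
  exact ⟨q1, q2, by unfold thetaC; exact q3⟩

end Summit.AtomisticToContinuum.HydrodynamicLimit.Theorems.LocalSecondLawLedger

end
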